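import Mathlib
import Literature.Analysis.FluidPDE.HardSphereCollisionRecord
import Literature.MathematicalPhysics.KineticTheory.HardSphereEuler
import Literature.MathematicalPhysics.KineticTheory.HardSphereEulerProofs
import Summits.AtomisticToContinuum.HydrodynamicLimit.Theses.OneFlightGossipEngine
import Summits.AtomisticToContinuum.HydrodynamicLimit.Theorems.OneFlightGossipEngineOneFlightLayeredChaosRegimes
import Summits.AtomisticToContinuum.HydrodynamicLimit.Theorems.OneFlightGossipEngineOneFlightLayeredChaosFluxRegimes
import Summits.AtomisticToContinuum.HydrodynamicLimit.Theorems.OneFlightGossipEngineOneFlightLayeredChaosWrapGeometry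
import Summits.AtomisticToContinuum.HydrodynamicLimit.Theorems.OneFlightGossipEngineOneFlightLayeredChaosNoWrap
import HarnessLib

/-!
# `OneFlightGossipEngine.OneFlightLayeredChaos` — the same-start event at `n ≥ 1` (torus wrap-around) is negligible
(crux stmt-AtomisticToContinuum-14535, line `Sketch`, lead cycle c3; glue of the registered stubs
`stub_sameStart_wrap_geometry` (p127771) and `stub_noWrap` (p127909))

The window event of the crux is decomposed by regimes (`Theorems.OLC.Regime`); the same-start atom `{s_i = s_j}`
(`OLC.shortGap θ₀ 0`) is split along `n` by the constant regime `OLC.nZero = {n = 0}`. This file proves the crux's body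
on the piece `{s_i = s_j} ∩ {n ≥ 1}`: on `Φ.good ∩ W` that event is a double collision of `i` with its `n`-th partner in
free flight, which on `𝕋³` wraps around the torus and forces some particle to travel `≥ 1/4` inside the kinetic window
(`Theorems.stub_sameStart_wrap_geometry`), an event of Gibbs probability `≤ δ` for `N ≥ N₀(θ₀, σ, τ, δ)`
(`Theorems.stub_noWrap`); since the defect on a regime `X` never exceeds `P(W ∩ X)` and `P(goodᶜ) = 0`, the body holds
with `C = 1`, `p = 1`, `σ₀ = 1/4`.

* `OLC.nZero` — the regime `{n = 0}`; `OLC.measurableSet_good_inter_nZero`.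
* `OLC.centring_le_one` (`u(B) ≤ 1`), `OLC.abs_measure_inter_sub_mul_le` (trivial bound `≤ P(W ∩ F)`).
* `OLC.regimeBody_sameStart_wrap : 0 < θ₀ → RegimeBody θ₀ ((shortGap θ₀ 0).inter nZero.compl)`.
-/

open scoped BigOperators ENNReal
open MeasureTheory Set
open Literature.Analysis.FluidPDE Literature.MathematicalPhysics.KineticTheory
open Summit.AtomisticToContinuum.HydrodynamicLimit.Theses.OneFlightGossipEngine

namespace Summit.AtomisticToContinuum.HydrodynamicLimit.Theorems.OLC

noncomputable section

/-- The regime `{n = 0}`: the collision under study is the FIRST collision of `i` after time `0` (so that `i`'s flight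
start is time `0`). A constant event for each `n` (all of phase space or nothing). [folklore] -/
def nZero : Regime := fun _ n _ _ _ => {_z | n = 0}

/-- The regime `{n = 0}` is measurable on the good set (it is constant in `z`). [folklore] -/
theorem measurableSet_good_inter_nZero (σ : ℝ) (n N : ℕ)
    (Φ : HardSphereFlow (Torus.geometry (Fin 3)) (hsDiameter σ N) (N + 1)) (i : Fin (N + 1)) :
    MeasurableSet (Φ.good ∩ nZero σ n N Φ i) :=
  Φ.measurableSet_good.inter (MeasurableSet.const (n = 0))

/-- The surface measure of the unit sphere of `ℝ³` is finite. [folklore] -/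
theorem isFiniteMeasure_sphereMeasure_V3 : IsFiniteMeasure (sphereMeasure (E := V3)) := by
  -- adapted from Cruxes/OneFlightLayeredChaos/Disproof.lean (refuter cdisprove), same statement
  unfold sphereMeasure; infer_instance

/-- The centring `u(B)` of the crux (uniform probability of `B ∩ S²`) is at most `1`. [folklore] -/
theorem centring_le_one (B : Set V3) :
    (((sphereMeasure (E := V3)) Set.univ)⁻¹ * (sphereMeasure (E := V3)) {ω | (ω : V3) ∈ B}).toReal ≤ 1 := by
  -- adapted from Cruxes/OneFlightLayeredChaos/Disproof.lean `u_le_one` (refuter cdisprove)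
  haveI := isFiniteMeasure_sphereMeasure_V3
  have hne : (sphereMeasure (E := V3)) Set.univ ≠ 0 := by
    unfold sphereMeasure
    exact Measure.measure_univ_ne_zero.2 (Measure.toSphere_ne_zero _)
  have hle : ((sphereMeasure (E := V3)) Set.univ)⁻¹ * (sphereMeasure (E := V3)) {ω | (ω : V3) ∈ B} ≤ 1 := by
    calc ((sphereMeasure (E := V3)) Set.univ)⁻¹ * (sphereMeasure (E := V3)) {ω | (ω : V3) ∈ B}
        ≤ ((sphereMeasure (E := V3)) Set.univ)⁻¹ * (sphereMeasure (E := V3)) Set.univ := by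
          gcongr; exact Set.subset_univ _
      _ = 1 := ENNReal.inv_mul_cancel hne (measure_ne_top _ _)
  simpa using ENNReal.toReal_mono ENNReal.one_ne_top hle

/-- Abstract trivial bound: for a finite measure and `u ∈ [0, 1]`, `|P(W ∩ A ∩ F) − u·P(W ∩ F)| ≤ P(W ∩ F)`. [folklore] -/
theorem abs_measure_inter_sub_mul_le {Ω : Type*} [MeasurableSpace Ω] (P : Measure Ω) [IsFiniteMeasure P]
    (W A F : Set Ω) {u : ℝ} (hu0 : 0 ≤ u) (hu1 : u ≤ 1) :
    |(P (W ∩ A ∩ F)).toReal - u * (P (W ∩ F)).toReal| ≤ (P (W ∩ F)).toReal := by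
  -- adapted from Cruxes/OneFlightLayeredChaos/Disproof.lean `abs_sub_mul_le_measure` (refuter cdisprove)
  have hle : (P (W ∩ A ∩ F)).toReal ≤ (P (W ∩ F)).toReal :=
    ENNReal.toReal_mono (measure_ne_top _ _) (measure_mono fun z hz => ⟨hz.1.1, hz.2⟩)
  have ha : 0 ≤ (P (W ∩ A ∩ F)).toReal := ENNReal.toReal_nonneg
  have hb : 0 ≤ (P (W ∩ F)).toReal := ENNReal.toReal_nonneg
  rw [abs_le]
  constructor <;> nlinarith

/-- **The crux's body on the same-start event at `n ≥ 1` (torus wrap-around).** The defect on a regime `X` never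
exceeds `P(W ∩ X)`; on `Φ.good`, `W ∩ {s_i = s_j} ∩ {n ≥ 1}` lies in the long-path event of
`Theorems.stub_sameStart_wrap_geometry`; `P(goodᶜ) = 0`; and `Theorems.stub_noWrap` makes the long-path event `≤ σ` for
`N ≥ N₀(σ, τ)`. Constants `C = 1`, `p = 1`, `σ₀ = 1/4` (so that `ε_N ≤ σ < 1/4`). (Registered helper of crux
stmt-AtomisticToContinuum-14535; stated in the registered `∀`-form.) [folklore] -/
theorem regimeBody_sameStart_wrap : ∀ {θ₀ : ℝ}, 0 < θ₀ → Summit.AtomisticToContinuum.HydrodynamicLimit.Theorems.OLC.RegimeBody θ₀ ((Summit.AtomisticToContinuum.HydrodynamicLimit.Theorems.OLC.shortGap θ₀ 0).inter Summit.AtomisticToContinuum.HydrodynamicLimit.Theorems.OLC.nZero.compl) := by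
  intro θ₀ hθ
  refine ⟨1, one_pos, 1, one_pos, 4⁻¹, by norm_num, fun σ hσ hσ4 => ?_⟩
  have hσ2 : σ ≤ 2⁻¹ := by linarith
  intro τ hτ n
  rcases Nat.eq_zero_or_pos n with hn0 | hn
  · -- `n = 0`: the regime is empty
    subst hn0
    refine ⟨0, fun N _ Φ i B _ => ?_⟩
    intro G ε w q P W A u E _
    have hempty : (shortGap θ₀ 0).inter nZero.compl σ 0 N Φ i = ∅ := by
      ext z
      simp [Regime.inter, Regime.compl, nZero]
    simp only [hempty, Set.empty_inter, Set.inter_empty, measure_empty, ENNReal.toReal_zero, mul_zero,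
      sub_zero, abs_zero]
    positivity
  · -- `n ≥ 1`: wrap-around, small probability
    have hδ : 0 < (1 : ℝ) * σ ^ (1 : ℝ) := by positivity
    obtain ⟨N₀, hN₀⟩ := Summit.AtomisticToContinuum.HydrodynamicLimit.Theorems.stub_noWrap hθ hσ hσ2 hτ hδ
    refine ⟨N₀, fun N hN Φ i B _ => ?_⟩
    intro G ε w q P W A u E _
    haveI : IsProbabilityMeasure P :=
      isProbabilityMeasure_localGibbsLaw continuous_const continuous_const continuous_const
        (fun _ => one_pos) (fun _ => hθ) (by linarith) N Φ
    set X : Set (Config (N + 1) (Fin 3) T3) := (shortGap θ₀ 0).inter nZero.compl σ n N Φ i with hX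
    -- the long-path event of the two closable stubs
    set L : Set (Config (N + 1) (Fin 3) T3) := {z | ∃ k : Fin (N + 1), ENNReal.ofReal (1 / 4) ≤
        ∫⁻ t in Set.Ioc 0 w, ENNReal.ofReal ‖(Φ.flow t z k).2‖} with hL
    have hεpos : 0 < ε := hsDiameter_pos hσ N
    have hε4 : ε < 4⁻¹ := (hsDiameter_le hσ.le N).trans_lt hσ4
    -- (1) trivial bound
    have h1 : |(P (W ∩ A ∩ (X ∩ E))).toReal - u * (P (W ∩ (X ∩ E))).toReal| ≤ (P (W ∩ (X ∩ E))).toReal :=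
      abs_measure_inter_sub_mul_le P W A (X ∩ E) ENNReal.toReal_nonneg (centring_le_one B)
    -- (2) `W ∩ X ⊆ L ∪ goodᶜ` by the geometry stub
    have h2 : W ∩ (X ∩ E) ⊆ L ∪ Φ.goodᶜ := by
      intro z hz
      by_cases hzg : z ∈ Φ.good
      · left
        have hzW : n + 1 ≤ Set.ncard (collisionTimesOf (Torus.geometry (Fin 3)) (hsDiameter σ N)
            (fun t => Φ.flow t z) i ∩ Set.Ioc 0 w) := hz.1
        have hzX : z ∈ X := hz.2.1
        rw [hX] at hzX
        simp only [Regime.inter, Regime.compl, shortGap, nZero, zero_mul, Set.mem_inter_iff, Set.mem_setOf_eq,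
          Set.mem_compl_iff] at hzX
        have hs := sub_eq_zero.1 (abs_nonpos_iff.1 hzX.1)
        exact Summit.AtomisticToContinuum.HydrodynamicLimit.Theorems.stub_sameStart_wrap_geometry
          hεpos hε4 Φ i hn w hzg hzW hs
      · right; exact hzg
    -- (3) measure bound
    have hnull : P Φ.goodᶜ = 0 := localGibbsLaw_one_compl_good σ θ₀ N Φ
    have hLbound : P L ≤ ENNReal.ofReal (1 * σ ^ (1 : ℝ)) := hN₀ N hN Φ
    have h3 : P (W ∩ (X ∩ E)) ≤ ENNReal.ofReal (1 * σ ^ (1 : ℝ)) :=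
      calc P (W ∩ (X ∩ E)) ≤ P (L ∪ Φ.goodᶜ) := measure_mono h2
        _ ≤ P L + P Φ.goodᶜ := measure_union_le _ _
        _ = P L := by rw [hnull, add_zero]
        _ ≤ ENNReal.ofReal (1 * σ ^ (1 : ℝ)) := hLbound
    have h4 : (P (W ∩ (X ∩ E))).toReal ≤ 1 * σ ^ (1 : ℝ) := by
      have := ENNReal.toReal_mono ENNReal.ofReal_ne_top h3
      rwa [ENNReal.toReal_ofReal hδ.le] at this
    exact h1.trans h4

end

end Summit.AtomisticToContinuum.HydrodynamicLimit.Theorems.OLC
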